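import Summits.CriticalPhenomena.PercolationContinuityZ3.Theorems.PercNearOneGluingNoHeavyLowerTailSahiLatinZeroBottomRelaxedBridgeChain

/-!
# `NoHeavyLowerTail` (crux stmt-CriticalPhenomena-4575), Sahi programme (prim-master-conj gen 50): the RELAXED GENERAL CORE, part 1 — the instance
# `P = [x₀=2] × S × Ω ⊂ P′ = [x₀≥1] × Ω`, `Q = Ω × T` (a threshold-relaxed literal TOGETHER WITH a private cut) and its four point densities

Support file (`--supports stmt-CriticalPhenomena-4575`; small definitions (`rcP`, `rcb`, `rcQ`, `rcc`) + proofs, no `sorry`, standard axioms).  Memo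
`run/shared/lean/prim/prim-l12/FROM-prim-master-conj-g50-GENERAL-CORE.md` §9.  Nothing here asserts the crux, Kahn's conjecture or (C¼).

THE MATHEMATICS.  On `[3]^{Fin 1 ⊕ (U ⊕ V)}` (points `(w, ξ, η)`): `P = {x₀ = 2} × S × Ω`, `b = P′ ∖ P = {x₀ = 1} × Ω ∪ {x₀ = 2} × Sᶜ × Ω` (a disjoint union),
`Q = Ω × Ω × T`, `c = Ω × Ω × Tᶜ`, for arbitrary `S ⊆ [3]^U`, `T ⊆ [3]^V`.  With `X = 2^{|U|}`, `Y = 2^{|V|}`, `N₁ = N_{lvl 1}(w)`, `N₂ = N_{lvl 2}(w)`,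
`α = N_S(ξ)`, `ᾱ = N_{Sᶜ}(ξ)`, `β = N_T(η)`, `β̄ = N_{Tᶜ}(η)` the block-independence dictionary of `…ZeroBottomProduct` / `…Factor` gives (`dSS_rc` … `dOO_rc`):
  `dSS = 4XY([w∈lvl 1] + [w∈lvl 2](1 − [ξ∈S][η∈T]))`,   `dSO = −2[w∈lvl 2][ξ∈S]Xβ̄ + ([w∈lvl 1] + [w∈lvl 2][ξ∉S])(6Xβ̄ − 2Xβ)`,
  `dOS = −[η∈T](N₁X + N₂ᾱ)Y − [η∉T]N₂αY + 3[η∉T](N₁X + N₂ᾱ)Y`,   `dOO = −4(N₁X + N₂ᾱ)β̄`.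
Additivity of the densities in `b` over a disjoint union (`dSS_union` …) reduces everything to factor/cylinder pieces.  The chain DP, the sum bound and the theorem are
the companion files `…RelaxedCoreChain`, `…RelaxedCoreCases`, `…RelaxedCore`. [this work]
-/

namespace Summit.CriticalPhenomena.PercolationContinuityZ3.Theorems.SahiLatin

open Finset

/-! ## §1  Additivity of the link counts and densities over disjoint unions -/

section additivity
variable {ι : Type*} [Fintype ι] [DecidableEq ι]

omit [DecidableEq ι] in
/-- `ind (s ∪ t) = ind s + ind t` for disjoint `s, t`. [this work] -/
theorem ind_union_of_disjoint {s t : Finset (Pt ι)} (h : Disjoint s t) (x : Pt ι) : ind (s ∪ t) x = ind s x + ind t x := by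
  by_cases hs : x ∈ s
  · have ht : x ∉ t := disjoint_left.1 h hs
    simp [hs, ht]
  · by_cases ht : x ∈ t <;> simp [hs, ht]

/-- `N_{s ∪ t} = N_s + N_t` for disjoint `s, t`. [this work] -/
theorem N_union_of_disjoint {s t : Finset (Pt ι)} (h : Disjoint s t) (u : Pt ι) : N (s ∪ t) u = N s u + N t u := by
  unfold N
  have e : (link u).filter (fun y => y ∈ s ∪ t) = (link u).filter (fun y => y ∈ s) ∪ (link u).filter (fun y => y ∈ t) := by
    ext y; simp only [mem_filter, mem_union]; tauto
  rw [e, card_union_of_disjoint (disjoint_filter.2 fun y _ hy hy' => disjoint_left.1 h hy hy')]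

/-- `Λ_{s ∪ t, c} = Λ_{s,c} + Λ_{t,c}` for disjoint `s, t`. [this work] -/
theorem Lam_union_left_of_disjoint {s t : Finset (Pt ι)} (h : Disjoint s t) (c : Finset (Pt ι)) (u : Pt ι) :
    Lam (s ∪ t) c u = Lam s c u + Lam t c u := by
  unfold Lam
  have e : (link u).filter (fun y => y ∈ s ∪ t ∧ anti u y ∈ c) =
      (link u).filter (fun y => y ∈ s ∧ anti u y ∈ c) ∪ (link u).filter (fun y => y ∈ t ∧ anti u y ∈ c) := by
    ext y; simp only [mem_filter, mem_union]; tauto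
  rw [e, card_union_of_disjoint (disjoint_filter.2 fun y _ hy hy' => disjoint_left.1 h hy.1 hy'.1)]

end additivity

/-! ## §2  The instance -/

section inst
variable {U V : Type} [Fintype U] [DecidableEq U] [Fintype V] [DecidableEq V] (S : Finset (Pt U)) (T : Finset (Pt V))

/-- `P = {x₀ = 2} × S × Ω`. [this work] -/
def rcP : Finset (Pt (Fin 1 ⊕ (U ⊕ V))) := cylL (lvl 2) ∩ cylR (cylL S)
/-- `b = {x₀ = 1} × Ω ∪ {x₀ = 2} × Sᶜ × Ω` (`= P′ ∖ P` for `P′ = {x₀ ≥ 1}`). [this work] -/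
def rcb : Finset (Pt (Fin 1 ⊕ (U ⊕ V))) := cylL (lvl 1) ∪ (cylL (lvl 2) ∩ cylR (cylL Sᶜ))
/-- `Q = Ω × Ω × T`. [this work] -/
def rcQ : Finset (Pt (Fin 1 ⊕ (U ⊕ V))) := cylR (cylR T)
/-- `c = Ω × Ω × Tᶜ`. [this work] -/
def rcc : Finset (Pt (Fin 1 ⊕ (U ⊕ V))) := cylR (cylR Tᶜ)

/-- The two pieces of `b` are disjoint. [this work] -/
theorem disjoint_rcb_pieces : Disjoint (cylL (lvl 1) : Finset (Pt (Fin 1 ⊕ (U ⊕ V)))) (cylL (lvl 2) ∩ cylR (cylL Sᶜ)) := by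
  rw [disjoint_left]
  intro u hu hu'
  rw [mem_cylL] at hu
  rw [mem_inter, mem_cylL] at hu'
  simp only [lvl, mem_filter, mem_univ, true_and] at hu hu'
  rw [hu] at hu'
  exact absurd hu'.1 (by decide)

/-! ## §3  The densities at a point `(w, ξ, η)` -/

/-- `dSS` of the relaxed general core. [this work] -/
theorem dSS_rc (w : Pt (Fin 1)) (ξ : Pt U) (η : Pt V) :
    dSS (rcP S) (rcb S) (rcQ T) (rcc T) (Sum.elim w (Sum.elim ξ η)) =
      4 * 2 ^ Fintype.card U * 2 ^ Fintype.card V *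
        (ind (lvl 1) w + ind (lvl 2) w * (1 - ind S ξ * ind T η)) := by
  unfold dSS rcP rcb rcQ rcc
  rw [ind_union_of_disjoint (disjoint_rcb_pieces S), ind_inter, ind_inter, Fintype.card_sum, Fintype.card_sum, Fintype.card_fin]
  simp only [ind_cylL, ind_cylR, fstPt_elim, sndPt_elim, ind_compl']
  ring

/-- `dSO` of the relaxed general core. [this work] -/
theorem dSO_rc (w : Pt (Fin 1)) (ξ : Pt U) (η : Pt V) :
    dSO (rcP S) (rcb S) (rcQ T) (rcc T) (Sum.elim w (Sum.elim ξ η)) =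
      -(2 * ind (lvl 2) w * ind S ξ * (2 ^ Fintype.card U * (N Tᶜ η : ℤ)))
        + (ind (lvl 1) w + ind (lvl 2) w * (1 - ind S ξ)) * (6 * (2 ^ Fintype.card U * (N Tᶜ η : ℤ)) - 2 * (2 ^ Fintype.card U * (N T η : ℤ))) := by
  have dQ : (N (rcQ T : Finset (Pt (Fin 1 ⊕ (U ⊕ V)))) (Sum.elim w (Sum.elim ξ η)) : ℤ) = 2 * (2 ^ Fintype.card U * N T η) := by
    unfold rcQ
    have h1 := N_cylR (U := Fin 1) (cylR T : Finset (Pt (U ⊕ V))) (Sum.elim w (Sum.elim ξ η))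
    have h2 := N_cylR (U := U) T (Sum.elim ξ η)
    rw [Fintype.card_fin, sndPt_elim] at h1; rw [sndPt_elim] at h2
    rw [h1, h2]; push_cast; ring
  have dc : (N (rcc T : Finset (Pt (Fin 1 ⊕ (U ⊕ V)))) (Sum.elim w (Sum.elim ξ η)) : ℤ) = 2 * (2 ^ Fintype.card U * N Tᶜ η) := by
    unfold rcc
    have h1 := N_cylR (U := Fin 1) (cylR Tᶜ : Finset (Pt (U ⊕ V))) (Sum.elim w (Sum.elim ξ η))
    have h2 := N_cylR (U := U) Tᶜ (Sum.elim ξ η)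
    rw [Fintype.card_fin, sndPt_elim] at h1; rw [sndPt_elim] at h2
    rw [h1, h2]; push_cast; ring
  unfold dSO
  rw [dQ, dc]
  unfold rcP rcb
  rw [ind_union_of_disjoint (disjoint_rcb_pieces S), ind_inter, ind_inter]
  simp only [ind_cylL, ind_cylR, fstPt_elim, sndPt_elim, ind_compl']
  ring

/-- `dOS` of the relaxed general core. [this work] -/
theorem dOS_rc (w : Pt (Fin 1)) (ξ : Pt U) (η : Pt V) :
    dOS (rcP S) (rcb S) (rcQ T) (rcc T) (Sum.elim w (Sum.elim ξ η)) =
      -(ind T η * (((N (lvl 1) w : ℤ) * 2 ^ Fintype.card U + (N (lvl 2) w : ℤ) * (N Sᶜ ξ : ℤ)) * 2 ^ Fintype.card V))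
        - ind Tᶜ η * ((N (lvl 2) w : ℤ) * (N S ξ : ℤ) * 2 ^ Fintype.card V)
        + 3 * (ind Tᶜ η * (((N (lvl 1) w : ℤ) * 2 ^ Fintype.card U + (N (lvl 2) w : ℤ) * (N Sᶜ ξ : ℤ)) * 2 ^ Fintype.card V)) := by
  have dP : (N (rcP S : Finset (Pt (Fin 1 ⊕ (U ⊕ V)))) (Sum.elim w (Sum.elim ξ η)) : ℤ) = N (lvl 2) w * (N S ξ * 2 ^ Fintype.card V) := by
    unfold rcP
    have h1 := N_cylL_inter_cylR (lvl 2) (cylL S : Finset (Pt (U ⊕ V))) (Sum.elim w (Sum.elim ξ η))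
    have h2 := N_cylL (V := V) S (Sum.elim ξ η)
    rw [fstPt_elim, sndPt_elim] at h1; rw [fstPt_elim] at h2
    rw [h1, h2]; push_cast; ring
  have db : (N (rcb S : Finset (Pt (Fin 1 ⊕ (U ⊕ V)))) (Sum.elim w (Sum.elim ξ η)) : ℤ) =
      N (lvl 1) w * 2 ^ Fintype.card U * 2 ^ Fintype.card V + N (lvl 2) w * (N Sᶜ ξ * 2 ^ Fintype.card V) := by
    unfold rcb
    rw [N_union_of_disjoint (disjoint_rcb_pieces S)]
    have h1 := N_cylL (V := U ⊕ V) (lvl 1) (Sum.elim w (Sum.elim ξ η))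
    have h2 := N_cylL_inter_cylR (lvl 2) (cylL Sᶜ : Finset (Pt (U ⊕ V))) (Sum.elim w (Sum.elim ξ η))
    have h3 := N_cylL (V := V) Sᶜ (Sum.elim ξ η)
    rw [fstPt_elim, Fintype.card_sum, pow_add] at h1; rw [fstPt_elim, sndPt_elim] at h2; rw [fstPt_elim] at h3
    rw [h1, h2, h3]; push_cast; ring
  unfold dOS
  rw [dP, db]
  unfold rcQ rcc
  rw [ind_cylR, ind_cylR, ind_cylR, ind_cylR]
  simp only [sndPt_elim]
  ring

/-- `dOO` of the relaxed general core: `−4(N₁X + N₂ᾱ)β̄`. [this work] -/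
theorem dOO_rc (w : Pt (Fin 1)) (ξ : Pt U) (η : Pt V) :
    dOO (rcP S) (rcb S) (rcQ T) (rcc T) (Sum.elim w (Sum.elim ξ η)) =
      -4 * (((N (lvl 1) w : ℤ) * 2 ^ Fintype.card U + (N (lvl 2) w : ℤ) * (N Sᶜ ξ : ℤ)) * (N Tᶜ η : ℤ)) := by
  -- set identities for the intersections
  have eQb : (rcQ T ∩ rcb S : Finset (Pt (Fin 1 ⊕ (U ⊕ V)))) =
      (cylL (lvl 1) ∩ cylR (cylR T)) ∪ (cylL (lvl 2) ∩ cylR (cylL Sᶜ ∩ cylR T)) := by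
    ext u; simp only [rcQ, rcb, mem_inter, mem_union, mem_cylL, mem_cylR]; tauto
  have ePc : (rcP S ∩ rcc T : Finset (Pt (Fin 1 ⊕ (U ⊕ V)))) = cylL (lvl 2) ∩ cylR (cylL S ∩ cylR Tᶜ) := by
    ext u; simp only [rcP, rcc, mem_inter, mem_cylL, mem_cylR]; tauto
  have ebc : (rcb S ∩ rcc T : Finset (Pt (Fin 1 ⊕ (U ⊕ V)))) =
      (cylL (lvl 1) ∩ cylR (cylR Tᶜ)) ∪ (cylL (lvl 2) ∩ cylR (cylL Sᶜ ∩ cylR Tᶜ)) := by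
    ext u; simp only [rcb, rcc, mem_inter, mem_union, mem_cylL, mem_cylR]; tauto
  have dj1 : Disjoint (cylL (lvl 1) ∩ cylR (cylR T) : Finset (Pt (Fin 1 ⊕ (U ⊕ V)))) (cylL (lvl 2) ∩ cylR (cylL Sᶜ ∩ cylR T)) := by
    rw [disjoint_left]; intro u hu hu'
    rw [mem_inter, mem_cylL] at hu hu'
    simp only [lvl, mem_filter, mem_univ, true_and] at hu hu'
    rw [hu.1] at hu'; exact absurd hu'.1 (by decide)
  have dj2 : Disjoint (cylL (lvl 1) ∩ cylR (cylR Tᶜ) : Finset (Pt (Fin 1 ⊕ (U ⊕ V)))) (cylL (lvl 2) ∩ cylR (cylL Sᶜ ∩ cylR Tᶜ)) := by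
    rw [disjoint_left]; intro u hu hu'
    rw [mem_inter, mem_cylL] at hu hu'
    simp only [lvl, mem_filter, mem_univ, true_and] at hu hu'
    rw [hu.1] at hu'; exact absurd hu'.1 (by decide)
  -- the point
  set u : Pt (Fin 1 ⊕ (U ⊕ V)) := Sum.elim w (Sum.elim ξ η) with hu
  have f1 : fstPt u = w := rfl
  have f2 : sndPt u = Sum.elim ξ η := rfl
  -- N of the three intersections
  have n1 : (N (rcQ T ∩ rcb S) u : ℤ) = N (lvl 1) w * (2 ^ Fintype.card U * N T η) + N (lvl 2) w * (N Sᶜ ξ * N T η) := by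
    rw [eQb, N_union_of_disjoint dj1, N_cylL_inter_cylR, N_cylL_inter_cylR, f1, f2, N_cylR, N_cylL_inter_cylR, sndPt_elim, fstPt_elim]
    push_cast; ring
  have n2 : (N (rcP S ∩ rcc T) u : ℤ) = N (lvl 2) w * (N S ξ * N Tᶜ η) := by
    rw [ePc, N_cylL_inter_cylR, f1, f2, N_cylL_inter_cylR, fstPt_elim, sndPt_elim]; push_cast; ring
  have n3 : (N (rcb S ∩ rcc T) u : ℤ) = N (lvl 1) w * (2 ^ Fintype.card U * N Tᶜ η) + N (lvl 2) w * (N Sᶜ ξ * N Tᶜ η) := by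
    rw [ebc, N_union_of_disjoint dj2, N_cylL_inter_cylR, N_cylL_inter_cylR, f1, f2, N_cylR, N_cylL_inter_cylR, sndPt_elim, fstPt_elim]
    push_cast; ring
  -- the three Λ's
  have l1 : (Lam (rcP S) (rcc T) u : ℤ) = N (lvl 2) w * (N S ξ * N Tᶜ η) := by
    unfold rcP rcc
    rw [Lam_prod_cylR, f1, f2, Lam_cylL_cylR, fstPt_elim, sndPt_elim]; push_cast; ring
  have l2 : (Lam (rcb S) (rcQ T) u : ℤ) = N (lvl 1) w * (2 ^ Fintype.card U * N T η) + N (lvl 2) w * (N Sᶜ ξ * N T η) := by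
    unfold rcb rcQ
    rw [Lam_union_left_of_disjoint (disjoint_rcb_pieces S), Lam_cylL_cylR, Lam_prod_cylR, f1, f2, N_cylR, Lam_cylL_cylR, sndPt_elim, fstPt_elim]
    push_cast; ring
  have l3 : (Lam (rcb S) (rcc T) u : ℤ) = N (lvl 1) w * (2 ^ Fintype.card U * N Tᶜ η) + N (lvl 2) w * (N Sᶜ ξ * N Tᶜ η) := by
    unfold rcb rcc
    rw [Lam_union_left_of_disjoint (disjoint_rcb_pieces S), Lam_cylL_cylR, Lam_prod_cylR, f1, f2, N_cylR, Lam_cylL_cylR, sndPt_elim, fstPt_elim]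
    push_cast; ring
  unfold dOO
  rw [l1, l2, l3, n1, n2, n3]
  ring

end inst

end Summit.CriticalPhenomena.PercolationContinuityZ3.Theorems.SahiLatin
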